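import Summits.BirchSwinnertonDyer.BirchSwinnertonDyer.Theorems.SignedLowerHalvesSmallImageLowerHalfBothSignsRttLineClosing
import Summits.BirchSwinnertonDyer.BirchSwinnertonDyer.Theorems.SignedLowerHalvesSmallImageLowerHalfBothSignsRttFloorCert
import Summits.BirchSwinnertonDyer.BirchSwinnertonDyer.Theorems.SignedLowerHalvesSmallImageLowerHalfBothSignsRttTierUnitRecords03
import Summits.BirchSwinnertonDyer.BirchSwinnertonDyer.Theorems.SignedLowerHalvesSmallImageLowerHalfBothSignsRttSplitCloserRecords02
import Summits.BirchSwinnertonDyer.Rank1Residual.X9.ChaDescentRecords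
import Literature.NumberTheory.EllipticCurves.IsogenyHasCMIffJMemProofs
import HarnessLib

/-!
# Route `SignedLowerHalves`, crux L `SmallImageLowerHalfBothSigns` (item stmt-BirchSwinnertonDyer-23599), line `rtt_w3` v48:
# PER-PAIR RECORDS at `p = 11` and `p = 7`, part B — Kobayashi's SIGNED MAIN CONJECTURE (`ε₀ = +1`) and lower divisibility (both signs)
# for the other five never-partnered pairs `232544i1`, `465088bc1`, `465088be1 @ 11` and `245456c1`, `353925ce1 @ 7`, BY NAME from P6 + ONE row each

One-shot seat `bsd-line-k3-pairs-p1` g0 (director-bsd g27 (1008)(a); LEAD g17's `SCOPE-perpair-g17.md` d2f543dbac698fca §3–§4, option (b1));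
`--supports stmt-BirchSwinnertonDyer-23599 --as helper`; THEOREMS ONLY (no `def`/instance/notation/named fact/`sorry`/`native_decide`); count-neutral.
Companion of part A (`…SmallImageRttPairRecords7and11`: the headline pairs `232544f1 @ 11`, `245456b1 @ 7`, same composition, plus `ε₀ = −1` twins).
HONEST STATUS (verbatim sense of the head). Every ★ theorem below is a PER-PAIR CONDITIONAL RECORD: the FULL signed main conjecture
`KobayashiMainConjecture W p 1` (certified sign `ε₀ = +1`) AND Kobayashi's lower divisibility for both signs, for THIS curve at THIS `p`,
modulo (i) the 22 typed print facts of crux L's cite stub (hypotheses `hJ … hRes` of P6's `…RttLineClosing`, p836246; TYPED ≠ PROVED), (ii) ONE displayed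
two-engine Mazur–Tate row `hrow` of the pair (EVEN layer, Pollack index `2`), and (iii) ONE displayed image datum `hNS : ¬ Surj W p` (option (b1):
mod-`p` image = normaliser of a non-split Cartan, a non-CM rational point of `X_ns⁺(p)`; no partner-free certificate in the tree at `p ∈ {7, 11}`).
First per-curve SIGNED MAIN CONJECTURE records at `p = 7` / `p = 11` (with part A) ON THE SMALL-IMAGE CLASS (`¬ Surj`; the tree's 53 / 111 per-curve
`KobayashiMainConjecture W 7 / 11 ε` theorems, `…LargeImageMazurTateRecordsNN`, all carry `hsurj`, crux 3) and first partner-free per-curve road there (no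
CM partner, no `BSD_p`, no exact descent, no rank / `L`-value / split binder); the lower-divisibility halves of these five pairs were ALREADY
recorded by other roads (unit zone `…_u465088bc1/be1_11_of_unitZone`, split closer `…_t232544i1_11/_t245456c1_7/_t353925ce1_7_of_split_of_
mazurTateRows`) — the new content is the EQUALITY (upper divisibility) for `ε₀ = +1`. Closes NOTHING class-wide: item 23599, crux L (class-wide,
all `p`), crux M and BSD remain OPEN; BSD is proved for NO curve by this file.

COMPOSITION, all BY NAME, exactly as in part A (P6's `kobayashiMainConjecture_of_prints_of_oneSignFloorAt` with `hfl` :=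
`SmallImageRttOneSided.oneSignFloor_of_mazurTateRowEven … (Even 2) hrow`, …RttFloorCert §2, Pollack 2003 Prop. 6.9/6.10/6.18, Cor. 5.11; both signs
by sign idleness on X7, `SignDefect.X7.exists_kobayashiLowerDivisibility_iff_forall`, period facts := the tree theorems
`Theorems.realPeriodRat_eq_unit_mul_plusPeriod(_three)_holds`); kernel-decided per pair in §1 with the LANDED point counts `card_t232544i1_11`,
`card_u465088bc1_11`, `card_u465088be1_11`, `card_t245456c1_7`, `card_t353925ce1_7`. SOURCE OF THE ROWS (displayed, not kernel): kit j335262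
(`cdisprove-stmt-BirchSwinnertonDyer-23599` g0, PREREG `gvkan2` 839c353487edc3e8; `gvkan2/LAYERS.tsv` sha16 09c04126f37ca31c, `MUONESIGN.tsv`
b6f406fadb903af2 verdict `UNIT-BOTH`; evidence #53–#56 of 2026-08-29 on the item), TWO engines per row, status `2eng`, 0 disagreements in `(μ, λ)`:
engine B = `msengine` (numerical modular symbols + integrality certificate, `symbols_ok`) + `iwlayer`, engine E = `eclib` exact modular symbols;
table level `n` ↦ Pollack index `n − 1`; the `∃ Θ`-form of `hrow` is invariant under the `p`-adic-unit period ratio Cremona `Ω` / `plusPeriod f`.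

References: [Kobayashi2003] Conjecture (p. 2), Thm. 1.2, 4.1, 7.4; [Pollack2003] Prop. 6.9, 6.10, 6.18, Cor. 5.11, Conj. 6.3; [PollackWeston2011MT] §3.1, Thm. 4.1;
[GreenbergVatsal2000] §3 Rem. 3.4; [Cremona2006] Table 1 (labels 232544i1, 465088bc1, 465088be1, 245456c1, 353925ce1); [SilvermanAEC2009] VII.5 Prop. 5.1, App. C §11. -/

set_option autoImplicit false
-- D-0017: single-problem summit, the namespace repeats the problem name by design.
set_option linter.dupNamespace false
noncomputable section

open scoped Classical MatrixGroups ModularForm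

open CongruenceSubgroup WeierstrassCurve Literature.NumberTheory.EllipticCurves
  Literature.NumberTheory.EllipticCurves.ModularForms
  Literature.NumberTheory.EllipticCurves.Kobayashi2003 ZpExtension
  Literature.NumberTheory.EllipticCurves.GreenbergVatsal2000
  Literature.NumberTheory.EllipticCurves.Rank1Residual
  Literature.NumberTheory.EllipticCurves.Rank1Residual.Typed
  Literature.NumberTheory.EllipticCurves.Rank1Residual.X11RankOneCertificates
  Literature.NumberTheory.IwasawaTheory
  Summit.BirchSwinnertonDyer.BirchSwinnertonDyer.Rank1Residual.IntModel
  Summit.BirchSwinnertonDyer.BirchSwinnertonDyer.Rank1Residual.X11RankOne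
  Summit.BirchSwinnertonDyer.Rank1Residual.X11b
  Summit.BirchSwinnertonDyer.Rank1Residual.X1
  Summit.BirchSwinnertonDyer.Rank1Residual.X1.MuLambda
  Summit.BirchSwinnertonDyer.Rank1Residual.Supersingular
  Summit.BirchSwinnertonDyer.BirchSwinnertonDyer.Theorems

namespace Summit.BirchSwinnertonDyer.BirchSwinnertonDyer.Theorems.SmallImageRttLine

/-! ## §1 Kernel-decided inputs of the five pairs (class X7, `a_p = 0`, non-CM) -/

/-- **Kernel data of `232544i1 @ 11`** (Cremona's minimal model `[0, 0, 0, −6682520, 39157150032]`, `N = 232544 = 2⁵·13²·43`): `ClassX7 W 11` (`11 ∤ Δ_min`; `#Ẽ(𝔽₁₁) = 12` by the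
landed count `card_t232544i1_11`, so `a₁₁ = 0`; additive at `13`: `13 ∣ Δ, c₄`), `a₁₁ = 0`, and `W` is non-CM (`j = c₄³/Δ ∉ cmJInvariants`, kernel).
[cite: Cremona2006, Table 1 (Cremona label 232544i1)] [cite: SilvermanAEC2009, VII.5 Prop. 5.1 and App. C §11] -/
theorem classX7_frobeniusTrace_not_hasCM_c232544i1_11 (W : WeierstrassCurve ℚ) [W.IsElliptic] [W.IsGloballyMinimal]
    [Fact (Nat.Prime 11)] (hW : W = ⟨0, 0, 0, -6682520, 39157150032⟩) :
    ClassX7 W 11 ∧ W.frobeniusTrace 11 = 0 ∧ ¬ W.HasCM := by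
  have hIW : integralModelInt W = ⟨0, 0, 0, -6682520, 39157150032⟩ :=
    integralModelInt_eq_of_map_eq _ (by rw [hW]; ext <;> simp [WeierstrassCurve.map])
  have hΔ : (⟨0, 0, 0, -6682520, 39157150032⟩ : WeierstrassCurve ℤ).Δ = discOf [0, 0, 0, -6682520, 39157150032] :=
    intCurve_Δ 0 0 0 (-6682520) 39157150032
  have hc₄ : (⟨0, 0, 0, -6682520, 39157150032⟩ : WeierstrassCurve ℤ).c₄ = c4Of [0, 0, 0, -6682520, 39157150032] :=
    intCurve_c₄ 0 0 0 (-6682520) 39157150032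
  have hgood : W.HasGoodReductionAtPrime 11 :=
    hasGoodReductionAtPrime_of_not_dvd W 11 (by rw [minimalDiscriminantInt_eq hIW, hΔ]; decide +kernel)
  have hap : W.frobeniusTrace 11 = 0 := by rw [frobeniusTrace_eq hIW SmallImageRttOneSided.card_t232544i1_11]; norm_num
  have hX : ClassX7 W 11 :=
    ⟨⟨hgood, by rw [hap]; exact dvd_zero _⟩, not_semistable_of_intModel hIW 13 (by norm_num) (by rw [hΔ]; decide +kernel)
      (by rw [hc₄]; decide +kernel)⟩
  have hcm : ¬ W.HasCM := fun h ↦ by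
    have hj := (hasCM_iff_j_mem_holds W).mp h
    rw [Summit.BirchSwinnertonDyer.Rank1Residual.X9.j_eq_of_intModel 0 0 0 (-6682520) 39157150032 hIW] at hj
    exact absurd hj (by decide +kernel)
  exact ⟨hX, hap, hcm⟩

/-- **Kernel data of `465088bc1 @ 11`** (Cremona's minimal model `[0, 0, 0, −1670630, 4894643754]`, `N = 465088 = 2⁶·13²·43`): `ClassX7 W 11` (`11 ∤ Δ_min`; `#Ẽ(𝔽₁₁) = 12` by the
landed count `card_u465088bc1_11`, so `a₁₁ = 0`; additive at `13`: `13 ∣ Δ, c₄`), `a₁₁ = 0`, and `W` is non-CM (`j = c₄³/Δ ∉ cmJInvariants`, kernel).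
[cite: Cremona2006, Table 1 (Cremona label 465088bc1)] [cite: SilvermanAEC2009, VII.5 Prop. 5.1 and App. C §11] -/
theorem classX7_frobeniusTrace_not_hasCM_c465088bc1_11 (W : WeierstrassCurve ℚ) [W.IsElliptic] [W.IsGloballyMinimal]
    [Fact (Nat.Prime 11)] (hW : W = ⟨0, 0, 0, -1670630, 4894643754⟩) :
    ClassX7 W 11 ∧ W.frobeniusTrace 11 = 0 ∧ ¬ W.HasCM := by
  have hIW : integralModelInt W = ⟨0, 0, 0, -1670630, 4894643754⟩ :=
    integralModelInt_eq_of_map_eq _ (by rw [hW]; ext <;> simp [WeierstrassCurve.map])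
  have hΔ : (⟨0, 0, 0, -1670630, 4894643754⟩ : WeierstrassCurve ℤ).Δ = discOf [0, 0, 0, -1670630, 4894643754] :=
    intCurve_Δ 0 0 0 (-1670630) 4894643754
  have hc₄ : (⟨0, 0, 0, -1670630, 4894643754⟩ : WeierstrassCurve ℤ).c₄ = c4Of [0, 0, 0, -1670630, 4894643754] :=
    intCurve_c₄ 0 0 0 (-1670630) 4894643754
  have hgood : W.HasGoodReductionAtPrime 11 :=
    hasGoodReductionAtPrime_of_not_dvd W 11 (by rw [minimalDiscriminantInt_eq hIW, hΔ]; decide +kernel)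
  have hap : W.frobeniusTrace 11 = 0 := by rw [frobeniusTrace_eq hIW SmallImageRttOneSided.card_u465088bc1_11]; norm_num
  have hX : ClassX7 W 11 :=
    ⟨⟨hgood, by rw [hap]; exact dvd_zero _⟩, not_semistable_of_intModel hIW 13 (by norm_num) (by rw [hΔ]; decide +kernel)
      (by rw [hc₄]; decide +kernel)⟩
  have hcm : ¬ W.HasCM := fun h ↦ by
    have hj := (hasCM_iff_j_mem_holds W).mp h
    rw [Summit.BirchSwinnertonDyer.Rank1Residual.X9.j_eq_of_intModel 0 0 0 (-1670630) 4894643754 hIW] at hj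
    exact absurd hj (by decide +kernel)
  exact ⟨hX, hap, hcm⟩

/-- **Kernel data of `465088be1 @ 11`** (Cremona's minimal model `[0, 0, 0, −282336470, 10753532327538]`, `N = 465088 = 2⁶·13²·43`): `ClassX7 W 11` (`11 ∤ Δ_min`; `#Ẽ(𝔽₁₁) = 12` by the
landed count `card_u465088be1_11`, so `a₁₁ = 0`; additive at `13`: `13 ∣ Δ, c₄`), `a₁₁ = 0`, and `W` is non-CM (`j = c₄³/Δ ∉ cmJInvariants`, kernel).
[cite: Cremona2006, Table 1 (Cremona label 465088be1)] [cite: SilvermanAEC2009, VII.5 Prop. 5.1 and App. C §11] -/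
theorem classX7_frobeniusTrace_not_hasCM_c465088be1_11 (W : WeierstrassCurve ℚ) [W.IsElliptic] [W.IsGloballyMinimal]
    [Fact (Nat.Prime 11)] (hW : W = ⟨0, 0, 0, -282336470, 10753532327538⟩) :
    ClassX7 W 11 ∧ W.frobeniusTrace 11 = 0 ∧ ¬ W.HasCM := by
  have hIW : integralModelInt W = ⟨0, 0, 0, -282336470, 10753532327538⟩ :=
    integralModelInt_eq_of_map_eq _ (by rw [hW]; ext <;> simp [WeierstrassCurve.map])
  have hΔ : (⟨0, 0, 0, -282336470, 10753532327538⟩ : WeierstrassCurve ℤ).Δ = discOf [0, 0, 0, -282336470, 10753532327538] :=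
    intCurve_Δ 0 0 0 (-282336470) 10753532327538
  have hc₄ : (⟨0, 0, 0, -282336470, 10753532327538⟩ : WeierstrassCurve ℤ).c₄ = c4Of [0, 0, 0, -282336470, 10753532327538] :=
    intCurve_c₄ 0 0 0 (-282336470) 10753532327538
  have hgood : W.HasGoodReductionAtPrime 11 :=
    hasGoodReductionAtPrime_of_not_dvd W 11 (by rw [minimalDiscriminantInt_eq hIW, hΔ]; decide +kernel)
  have hap : W.frobeniusTrace 11 = 0 := by rw [frobeniusTrace_eq hIW SmallImageRttOneSided.card_u465088be1_11]; norm_num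
  have hX : ClassX7 W 11 :=
    ⟨⟨hgood, by rw [hap]; exact dvd_zero _⟩, not_semistable_of_intModel hIW 13 (by norm_num) (by rw [hΔ]; decide +kernel)
      (by rw [hc₄]; decide +kernel)⟩
  have hcm : ¬ W.HasCM := fun h ↦ by
    have hj := (hasCM_iff_j_mem_holds W).mp h
    rw [Summit.BirchSwinnertonDyer.Rank1Residual.X9.j_eq_of_intModel 0 0 0 (-282336470) 10753532327538 hIW] at hj
    exact absurd hj (by decide +kernel)
  exact ⟨hX, hap, hcm⟩

/-- **Kernel data of `245456c1 @ 7`** (Cremona's minimal model `[0, 1, 0, −162533, −51299309]`, `N = 245456 = 2⁴·23²·29`): `ClassX7 W 7` (`7 ∤ Δ_min`; `#Ẽ(𝔽₇) = 8` by the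
landed count `card_t245456c1_7`, so `a₇ = 0`; additive at `23`: `23 ∣ Δ, c₄`), `a₇ = 0`, and `W` is non-CM (`j = c₄³/Δ ∉ cmJInvariants`, kernel).
[cite: Cremona2006, Table 1 (Cremona label 245456c1)] [cite: SilvermanAEC2009, VII.5 Prop. 5.1 and App. C §11] -/
theorem classX7_frobeniusTrace_not_hasCM_c245456c1_7 (W : WeierstrassCurve ℚ) [W.IsElliptic] [W.IsGloballyMinimal]
    [Fact (Nat.Prime 7)] (hW : W = ⟨0, 1, 0, -162533, -51299309⟩) :
    ClassX7 W 7 ∧ W.frobeniusTrace 7 = 0 ∧ ¬ W.HasCM := by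
  have hIW : integralModelInt W = ⟨0, 1, 0, -162533, -51299309⟩ :=
    integralModelInt_eq_of_map_eq _ (by rw [hW]; ext <;> simp [WeierstrassCurve.map])
  have hΔ : (⟨0, 1, 0, -162533, -51299309⟩ : WeierstrassCurve ℤ).Δ = discOf [0, 1, 0, -162533, -51299309] :=
    intCurve_Δ 0 1 0 (-162533) (-51299309)
  have hc₄ : (⟨0, 1, 0, -162533, -51299309⟩ : WeierstrassCurve ℤ).c₄ = c4Of [0, 1, 0, -162533, -51299309] :=
    intCurve_c₄ 0 1 0 (-162533) (-51299309)
  have hgood : W.HasGoodReductionAtPrime 7 :=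
    hasGoodReductionAtPrime_of_not_dvd W 7 (by rw [minimalDiscriminantInt_eq hIW, hΔ]; decide +kernel)
  have hap : W.frobeniusTrace 7 = 0 := by rw [frobeniusTrace_eq hIW SmallImageRttOneSided.card_t245456c1_7]; norm_num
  have hX : ClassX7 W 7 :=
    ⟨⟨hgood, by rw [hap]; exact dvd_zero _⟩, not_semistable_of_intModel hIW 23 (by norm_num) (by rw [hΔ]; decide +kernel)
      (by rw [hc₄]; decide +kernel)⟩
  have hcm : ¬ W.HasCM := fun h ↦ by
    have hj := (hasCM_iff_j_mem_holds W).mp h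
    rw [Summit.BirchSwinnertonDyer.Rank1Residual.X9.j_eq_of_intModel 0 1 0 (-162533) (-51299309) hIW] at hj
    exact absurd hj (by decide +kernel)
  exact ⟨hX, hap, hcm⟩

/-- **Kernel data of `353925ce1 @ 7`** (Cremona's minimal model `[0, 0, 1, 147741000, 99524485156]`, `N = 353925 = 3²·5²·11²·13`): `ClassX7 W 7` (`7 ∤ Δ_min`; `#Ẽ(𝔽₇) = 8` by the
landed count `card_t353925ce1_7`, so `a₇ = 0`; additive at `11`: `11 ∣ Δ, c₄`), `a₇ = 0`, and `W` is non-CM (`j = c₄³/Δ ∉ cmJInvariants`, kernel).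
[cite: Cremona2006, Table 1 (Cremona label 353925ce1)] [cite: SilvermanAEC2009, VII.5 Prop. 5.1 and App. C §11] -/
theorem classX7_frobeniusTrace_not_hasCM_c353925ce1_7 (W : WeierstrassCurve ℚ) [W.IsElliptic] [W.IsGloballyMinimal]
    [Fact (Nat.Prime 7)] (hW : W = ⟨0, 0, 1, 147741000, 99524485156⟩) :
    ClassX7 W 7 ∧ W.frobeniusTrace 7 = 0 ∧ ¬ W.HasCM := by
  have hIW : integralModelInt W = ⟨0, 0, 1, 147741000, 99524485156⟩ :=
    integralModelInt_eq_of_map_eq _ (by rw [hW]; ext <;> simp [WeierstrassCurve.map])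
  have hΔ : (⟨0, 0, 1, 147741000, 99524485156⟩ : WeierstrassCurve ℤ).Δ = discOf [0, 0, 1, 147741000, 99524485156] :=
    intCurve_Δ 0 0 1 147741000 99524485156
  have hc₄ : (⟨0, 0, 1, 147741000, 99524485156⟩ : WeierstrassCurve ℤ).c₄ = c4Of [0, 0, 1, 147741000, 99524485156] :=
    intCurve_c₄ 0 0 1 147741000 99524485156
  have hgood : W.HasGoodReductionAtPrime 7 :=
    hasGoodReductionAtPrime_of_not_dvd W 7 (by rw [minimalDiscriminantInt_eq hIW, hΔ]; decide +kernel)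
  have hap : W.frobeniusTrace 7 = 0 := by rw [frobeniusTrace_eq hIW SmallImageRttOneSided.card_t353925ce1_7]; norm_num
  have hX : ClassX7 W 7 :=
    ⟨⟨hgood, by rw [hap]; exact dvd_zero _⟩, not_semistable_of_intModel hIW 11 (by norm_num) (by rw [hΔ]; decide +kernel)
      (by rw [hc₄]; decide +kernel)⟩
  have hcm : ¬ W.HasCM := fun h ↦ by
    have hj := (hasCM_iff_j_mem_holds W).mp h
    rw [Summit.BirchSwinnertonDyer.Rank1Residual.X9.j_eq_of_intModel 0 0 1 147741000 99524485156 hIW] at hj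
    exact absurd hj (by decide +kernel)
  exact ⟨hX, hap, hcm⟩

/-! ## §2 The records: `KobayashiMainConjecture W p 1 ∧ ∀ ε, KobayashiLowerDivisibility W p ε` from the 22 prints, `hNS` and ONE even row -/

/-- ★ **PER-PAIR CONDITIONAL RECORD — `232544i1 @ 11`: Kobayashi's signed main conjecture `KobayashiMainConjecture W 11 (+1)` (certified sign
`ε₀ = +1`) AND lower divisibility for BOTH signs**, modulo (i) the 22 typed print facts of crux L's cite stub (`hJ … hRes`, hypotheses; typed ≠
proved), (ii) ONE displayed two-engine Mazur–Tate row `hrow` — kit j335262 `gvkan2/LAYERS.tsv` 09c04126f37ca31c, row `232544i1@11, level 3 = Pollack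
index 2, even, q = deg ω₂⁻ = 10`: `μ = 0, λ = 12 = 10 + 2`, engines B (`msengine`+`iwlayer`) and E (`eclib`) AGREE (lower rows: index 1 odd `μ = 0, λ = 2`; index 0 `μ = 1`, i.e. `11 ∣ L(E,1)/Ω = 22`)
⇒ `(μ, λ)(L⁺₁₁(E)) = (0, 2)` — and (iii) ONE displayed image datum `hNS : ¬ Surj W 11` (option (b1)). BY NAME: P6's
`kobayashiMainConjecture_of_prints_of_oneSignFloorAt` ∘ `SmallImageRttOneSided.oneSignFloor_of_mazurTateRowEven`, then sign idleness on X7; kernel: §1.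
Per pair; closes nothing class-wide; 23599, crux L, crux M and BSD remain OPEN; BSD is proved for no curve.
[cite: Kobayashi2003, Conjecture (p. 2), Thm. 1.2, Thm. 4.1, Thm. 7.4 (p. 13)] [cite: Pollack2003, Prop. 6.18, Cor. 5.11]
[cite: Cremona2006, Table 1 (Cremona label 232544i1)] -/
theorem kobayashiMainConjecture_and_forall_kobayashiLowerDivisibility_c232544i1_11_of_prints_of_mazurTateRow
    (hJ : thm62_63_73_signedColemanKato_zetaJoint) (h12 : thm12_signedSelmerDual_finite_torsion) (h41 : thm41_signedCharIdeal_divisibility)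
    (hD : Hida2000_thm326_exists_galoisRep) (hC : Carayol1986_artinConductorExponent)
    (hS : ∀ (V : WeierstrassCurve ℚ) (ℓ : ℕ) [Fact ℓ.Prime], V.swanConductorAt_rationalTate_eq_wildConductorExponent_of_ringChar_eq_two ℓ)
    (hmod : exists_isNewformOf) (hKim : BDKim2009.cor213_signedLambda_add_sum_delta_eq_of_torsionIso)
    (hPR : PollackRubin2004.mainTheorem_signedCharIdeal_eq_of_cm) (hV : vatsal1999_plusSymbol_congruence)
    (hK211 : BDKim2009.prop211_selmer_noFiniteSubmodule) (hK2526 : BDKim2009.cor25_prop26_selmer_lambda_eq_add_sum_delta)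
    (h53 : Literature.NumberTheory.ComplexMultiplication.EllipticUnits.JohnsonLeungKings2011.cor53_thm52ShapeO) (hKE : Literature.NumberTheory.ComplexMultiplication.EllipticUnits.Kato2004.sec155_exists_katoUnitRep)
    (h24i : Literature.NumberTheory.ComplexMultiplication.EllipticUnits.DeShalit1987.prop24_i_mem_rayClassField) (h24ii : Literature.NumberTheory.ComplexMultiplication.EllipticUnits.DeShalit1987.prop24_ii_galoisAction)
    (h25 : Literature.NumberTheory.ComplexMultiplication.EllipticUnits.DeShalit1987.prop25_i_normRelation)
    (hKP : KimPark2017.prop212_prop33_localSignedDual_free_rank_two) (hKPd : KimPark2017.def210_prop212_exists_signedNormSystem)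
    (hKP29 : KimPark2017.def210_prop29_exists_signedNormSystem_logSum)
    (hF1 : Literature.NumberTheory.EllipticCurves.Kato2004.CM.prop159_ellipticUnits_tatePairing_values_inert)
    (hRes : Literature.NumberTheory.EllipticCurves.ModularForms.Ribet1977_cmNewform_gamma0_badEulerFactor_padicCharacter)
    (W : WeierstrassCurve ℚ) [W.IsElliptic] [W.IsGloballyMinimal] [Fact (Nat.Prime 11)]
    (hW : W = ⟨0, 0, 0, -6682520, 39157150032⟩) (hNS : ¬ W.HasSurjectiveModNGaloisRep 11)
    (hrow : ∀ [NeZero (W.conductorNorm ℤ)] (f : CuspForm (Gamma0 (W.conductorNorm ℤ)) 2), IsNewformOf W f →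
      ∃ Θ : IwasawaAlgebra 11, iwasawaToPowerSeries 11 Θ =
          ((mazurTateElement f 11 2).map (algebraMap ℚ ℚ_[11]) : PowerSeries ℚ_[11]) ∧
        Θ ≠ 0 ∧ mu Θ = 0 ∧ lam Θ = (cyclotomicOmegaMinus 11 2).natDegree + 2) :
    KobayashiMainConjecture W 11 1 ∧ ∀ ε : ℤˣ, KobayashiLowerDivisibility W 11 ε := by
  obtain ⟨hX, hap, hcm⟩ := classX7_frobeniusTrace_not_hasCM_c232544i1_11 W hW
  have hMC : KobayashiMainConjecture W 11 1 :=
    kobayashiMainConjecture_of_prints_of_oneSignFloorAt hJ h12 h41 hD hC hS hmod hKim hPR hV hK211 hK2526 h53 hKE h24i h24ii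
      h25 hKP hKPd hKP29 hF1 hRes W 11 (by norm_num) hX hcm hap hNS 1
      (fun f hf Lplus Lminus hPP ↦ SmallImageRttOneSided.oneSignFloor_of_mazurTateRowEven W 11 (by norm_num) hX.1.1 hap
        (by decide : Even 2) hrow f hf Lplus Lminus hPP)
  exact ⟨hMC, fun ε ↦ (SignDefect.X7.exists_kobayashiLowerDivisibility_iff_forall W 11 h12
    Summit.BirchSwinnertonDyer.BirchSwinnertonDyer.Theorems.realPeriodRat_eq_unit_mul_plusPeriod_holds
    Summit.BirchSwinnertonDyer.BirchSwinnertonDyer.Theorems.realPeriodRat_eq_unit_mul_plusPeriod_three_holds hJ (by norm_num) hX hap).mp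
    ⟨1, kobayashiLowerDivisibility_of_mainConjecture hMC⟩ ε⟩

/-- ★ **PER-PAIR CONDITIONAL RECORD — `465088bc1 @ 11`: Kobayashi's signed main conjecture `KobayashiMainConjecture W 11 (+1)` (certified sign
`ε₀ = +1`) AND lower divisibility for BOTH signs**, modulo (i) the 22 typed print facts of crux L's cite stub (`hJ … hRes`, hypotheses; typed ≠
proved), (ii) ONE displayed two-engine Mazur–Tate row `hrow` — kit j335262 `gvkan2/LAYERS.tsv` 09c04126f37ca31c, row `465088bc1@11, level 3 = Pollack
index 2, even, q = deg ω₂⁻ = 10`: `μ = 0, λ = 10 = 10 + 0`, engines B (`msengine`+`iwlayer`) and E (`eclib`) AGREE (lower rows: index 1 odd `μ = 0, λ = 0`; index 0 `μ = 0, λ = 0`, i.e. `11 ∤ L(E,1)/Ω = 1`)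
⇒ `(μ, λ)(L⁺₁₁(E)) = (0, 0)` — and (iii) ONE displayed image datum `hNS : ¬ Surj W 11` (option (b1)). BY NAME: P6's
`kobayashiMainConjecture_of_prints_of_oneSignFloorAt` ∘ `SmallImageRttOneSided.oneSignFloor_of_mazurTateRowEven`, then sign idleness on X7; kernel: §1.
Per pair; closes nothing class-wide; 23599, crux L, crux M and BSD remain OPEN; BSD is proved for no curve.
[cite: Kobayashi2003, Conjecture (p. 2), Thm. 1.2, Thm. 4.1, Thm. 7.4 (p. 13)] [cite: Pollack2003, Prop. 6.18, Cor. 5.11]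
[cite: Cremona2006, Table 1 (Cremona label 465088bc1)] -/
theorem kobayashiMainConjecture_and_forall_kobayashiLowerDivisibility_c465088bc1_11_of_prints_of_mazurTateRow
    (hJ : thm62_63_73_signedColemanKato_zetaJoint) (h12 : thm12_signedSelmerDual_finite_torsion) (h41 : thm41_signedCharIdeal_divisibility)
    (hD : Hida2000_thm326_exists_galoisRep) (hC : Carayol1986_artinConductorExponent)
    (hS : ∀ (V : WeierstrassCurve ℚ) (ℓ : ℕ) [Fact ℓ.Prime], V.swanConductorAt_rationalTate_eq_wildConductorExponent_of_ringChar_eq_two ℓ)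
    (hmod : exists_isNewformOf) (hKim : BDKim2009.cor213_signedLambda_add_sum_delta_eq_of_torsionIso)
    (hPR : PollackRubin2004.mainTheorem_signedCharIdeal_eq_of_cm) (hV : vatsal1999_plusSymbol_congruence)
    (hK211 : BDKim2009.prop211_selmer_noFiniteSubmodule) (hK2526 : BDKim2009.cor25_prop26_selmer_lambda_eq_add_sum_delta)
    (h53 : Literature.NumberTheory.ComplexMultiplication.EllipticUnits.JohnsonLeungKings2011.cor53_thm52ShapeO) (hKE : Literature.NumberTheory.ComplexMultiplication.EllipticUnits.Kato2004.sec155_exists_katoUnitRep)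
    (h24i : Literature.NumberTheory.ComplexMultiplication.EllipticUnits.DeShalit1987.prop24_i_mem_rayClassField) (h24ii : Literature.NumberTheory.ComplexMultiplication.EllipticUnits.DeShalit1987.prop24_ii_galoisAction)
    (h25 : Literature.NumberTheory.ComplexMultiplication.EllipticUnits.DeShalit1987.prop25_i_normRelation)
    (hKP : KimPark2017.prop212_prop33_localSignedDual_free_rank_two) (hKPd : KimPark2017.def210_prop212_exists_signedNormSystem)
    (hKP29 : KimPark2017.def210_prop29_exists_signedNormSystem_logSum)
    (hF1 : Literature.NumberTheory.EllipticCurves.Kato2004.CM.prop159_ellipticUnits_tatePairing_values_inert)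
    (hRes : Literature.NumberTheory.EllipticCurves.ModularForms.Ribet1977_cmNewform_gamma0_badEulerFactor_padicCharacter)
    (W : WeierstrassCurve ℚ) [W.IsElliptic] [W.IsGloballyMinimal] [Fact (Nat.Prime 11)]
    (hW : W = ⟨0, 0, 0, -1670630, 4894643754⟩) (hNS : ¬ W.HasSurjectiveModNGaloisRep 11)
    (hrow : ∀ [NeZero (W.conductorNorm ℤ)] (f : CuspForm (Gamma0 (W.conductorNorm ℤ)) 2), IsNewformOf W f →
      ∃ Θ : IwasawaAlgebra 11, iwasawaToPowerSeries 11 Θ =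
          ((mazurTateElement f 11 2).map (algebraMap ℚ ℚ_[11]) : PowerSeries ℚ_[11]) ∧
        Θ ≠ 0 ∧ mu Θ = 0 ∧ lam Θ = (cyclotomicOmegaMinus 11 2).natDegree + 0) :
    KobayashiMainConjecture W 11 1 ∧ ∀ ε : ℤˣ, KobayashiLowerDivisibility W 11 ε := by
  obtain ⟨hX, hap, hcm⟩ := classX7_frobeniusTrace_not_hasCM_c465088bc1_11 W hW
  have hMC : KobayashiMainConjecture W 11 1 :=
    kobayashiMainConjecture_of_prints_of_oneSignFloorAt hJ h12 h41 hD hC hS hmod hKim hPR hV hK211 hK2526 h53 hKE h24i h24ii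
      h25 hKP hKPd hKP29 hF1 hRes W 11 (by norm_num) hX hcm hap hNS 1
      (fun f hf Lplus Lminus hPP ↦ SmallImageRttOneSided.oneSignFloor_of_mazurTateRowEven W 11 (by norm_num) hX.1.1 hap
        (by decide : Even 2) hrow f hf Lplus Lminus hPP)
  exact ⟨hMC, fun ε ↦ (SignDefect.X7.exists_kobayashiLowerDivisibility_iff_forall W 11 h12
    Summit.BirchSwinnertonDyer.BirchSwinnertonDyer.Theorems.realPeriodRat_eq_unit_mul_plusPeriod_holds
    Summit.BirchSwinnertonDyer.BirchSwinnertonDyer.Theorems.realPeriodRat_eq_unit_mul_plusPeriod_three_holds hJ (by norm_num) hX hap).mp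
    ⟨1, kobayashiLowerDivisibility_of_mainConjecture hMC⟩ ε⟩

/-- ★ **PER-PAIR CONDITIONAL RECORD — `465088be1 @ 11`: Kobayashi's signed main conjecture `KobayashiMainConjecture W 11 (+1)` (certified sign
`ε₀ = +1`) AND lower divisibility for BOTH signs**, modulo (i) the 22 typed print facts of crux L's cite stub (`hJ … hRes`, hypotheses; typed ≠
proved), (ii) ONE displayed two-engine Mazur–Tate row `hrow` — kit j335262 `gvkan2/LAYERS.tsv` 09c04126f37ca31c, row `465088be1@11, level 3 = Pollack
index 2, even, q = deg ω₂⁻ = 10`: `μ = 0, λ = 10 = 10 + 0`, engines B (`msengine`+`iwlayer`) and E (`eclib`) AGREE (lower rows: index 1 odd `μ = 0, λ = 0`; index 0 `μ = 0, λ = 0`, i.e. `11 ∤ L(E,1)/Ω = 3`)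
⇒ `(μ, λ)(L⁺₁₁(E)) = (0, 0)` — and (iii) ONE displayed image datum `hNS : ¬ Surj W 11` (option (b1)). BY NAME: P6's
`kobayashiMainConjecture_of_prints_of_oneSignFloorAt` ∘ `SmallImageRttOneSided.oneSignFloor_of_mazurTateRowEven`, then sign idleness on X7; kernel: §1.
Per pair; closes nothing class-wide; 23599, crux L, crux M and BSD remain OPEN; BSD is proved for no curve.
[cite: Kobayashi2003, Conjecture (p. 2), Thm. 1.2, Thm. 4.1, Thm. 7.4 (p. 13)] [cite: Pollack2003, Prop. 6.18, Cor. 5.11]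
[cite: Cremona2006, Table 1 (Cremona label 465088be1)] -/
theorem kobayashiMainConjecture_and_forall_kobayashiLowerDivisibility_c465088be1_11_of_prints_of_mazurTateRow
    (hJ : thm62_63_73_signedColemanKato_zetaJoint) (h12 : thm12_signedSelmerDual_finite_torsion) (h41 : thm41_signedCharIdeal_divisibility)
    (hD : Hida2000_thm326_exists_galoisRep) (hC : Carayol1986_artinConductorExponent)
    (hS : ∀ (V : WeierstrassCurve ℚ) (ℓ : ℕ) [Fact ℓ.Prime], V.swanConductorAt_rationalTate_eq_wildConductorExponent_of_ringChar_eq_two ℓ)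
    (hmod : exists_isNewformOf) (hKim : BDKim2009.cor213_signedLambda_add_sum_delta_eq_of_torsionIso)
    (hPR : PollackRubin2004.mainTheorem_signedCharIdeal_eq_of_cm) (hV : vatsal1999_plusSymbol_congruence)
    (hK211 : BDKim2009.prop211_selmer_noFiniteSubmodule) (hK2526 : BDKim2009.cor25_prop26_selmer_lambda_eq_add_sum_delta)
    (h53 : Literature.NumberTheory.ComplexMultiplication.EllipticUnits.JohnsonLeungKings2011.cor53_thm52ShapeO) (hKE : Literature.NumberTheory.ComplexMultiplication.EllipticUnits.Kato2004.sec155_exists_katoUnitRep)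
    (h24i : Literature.NumberTheory.ComplexMultiplication.EllipticUnits.DeShalit1987.prop24_i_mem_rayClassField) (h24ii : Literature.NumberTheory.ComplexMultiplication.EllipticUnits.DeShalit1987.prop24_ii_galoisAction)
    (h25 : Literature.NumberTheory.ComplexMultiplication.EllipticUnits.DeShalit1987.prop25_i_normRelation)
    (hKP : KimPark2017.prop212_prop33_localSignedDual_free_rank_two) (hKPd : KimPark2017.def210_prop212_exists_signedNormSystem)
    (hKP29 : KimPark2017.def210_prop29_exists_signedNormSystem_logSum)
    (hF1 : Literature.NumberTheory.EllipticCurves.Kato2004.CM.prop159_ellipticUnits_tatePairing_values_inert)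
    (hRes : Literature.NumberTheory.EllipticCurves.ModularForms.Ribet1977_cmNewform_gamma0_badEulerFactor_padicCharacter)
    (W : WeierstrassCurve ℚ) [W.IsElliptic] [W.IsGloballyMinimal] [Fact (Nat.Prime 11)]
    (hW : W = ⟨0, 0, 0, -282336470, 10753532327538⟩) (hNS : ¬ W.HasSurjectiveModNGaloisRep 11)
    (hrow : ∀ [NeZero (W.conductorNorm ℤ)] (f : CuspForm (Gamma0 (W.conductorNorm ℤ)) 2), IsNewformOf W f →
      ∃ Θ : IwasawaAlgebra 11, iwasawaToPowerSeries 11 Θ =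
          ((mazurTateElement f 11 2).map (algebraMap ℚ ℚ_[11]) : PowerSeries ℚ_[11]) ∧
        Θ ≠ 0 ∧ mu Θ = 0 ∧ lam Θ = (cyclotomicOmegaMinus 11 2).natDegree + 0) :
    KobayashiMainConjecture W 11 1 ∧ ∀ ε : ℤˣ, KobayashiLowerDivisibility W 11 ε := by
  obtain ⟨hX, hap, hcm⟩ := classX7_frobeniusTrace_not_hasCM_c465088be1_11 W hW
  have hMC : KobayashiMainConjecture W 11 1 :=
    kobayashiMainConjecture_of_prints_of_oneSignFloorAt hJ h12 h41 hD hC hS hmod hKim hPR hV hK211 hK2526 h53 hKE h24i h24ii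
      h25 hKP hKPd hKP29 hF1 hRes W 11 (by norm_num) hX hcm hap hNS 1
      (fun f hf Lplus Lminus hPP ↦ SmallImageRttOneSided.oneSignFloor_of_mazurTateRowEven W 11 (by norm_num) hX.1.1 hap
        (by decide : Even 2) hrow f hf Lplus Lminus hPP)
  exact ⟨hMC, fun ε ↦ (SignDefect.X7.exists_kobayashiLowerDivisibility_iff_forall W 11 h12
    Summit.BirchSwinnertonDyer.BirchSwinnertonDyer.Theorems.realPeriodRat_eq_unit_mul_plusPeriod_holds
    Summit.BirchSwinnertonDyer.BirchSwinnertonDyer.Theorems.realPeriodRat_eq_unit_mul_plusPeriod_three_holds hJ (by norm_num) hX hap).mp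
    ⟨1, kobayashiLowerDivisibility_of_mainConjecture hMC⟩ ε⟩

/-- ★ **PER-PAIR CONDITIONAL RECORD — `245456c1 @ 7`: Kobayashi's signed main conjecture `KobayashiMainConjecture W 7 (+1)` (certified sign
`ε₀ = +1`) AND lower divisibility for BOTH signs**, modulo (i) the 22 typed print facts of crux L's cite stub (`hJ … hRes`, hypotheses; typed ≠
proved), (ii) ONE displayed two-engine Mazur–Tate row `hrow` — kit j335262 `gvkan2/LAYERS.tsv` 09c04126f37ca31c, row `245456c1@7, level 3 = Pollack
index 2, even, q = deg ω₂⁻ = 6`: `μ = 0, λ = 8 = 6 + 2`, engines B (`msengine`+`iwlayer`) and E (`eclib`) AGREE (lower rows: index 1 odd `μ = 0, λ = 2`; index 0 `μ = 1`, i.e. `7 ∣ L(E,1)/Ω = 14`)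
⇒ `(μ, λ)(L⁺₇(E)) = (0, 2)` — and (iii) ONE displayed image datum `hNS : ¬ Surj W 7` (option (b1)). BY NAME: P6's
`kobayashiMainConjecture_of_prints_of_oneSignFloorAt` ∘ `SmallImageRttOneSided.oneSignFloor_of_mazurTateRowEven`, then sign idleness on X7; kernel: §1.
Per pair; closes nothing class-wide; 23599, crux L, crux M and BSD remain OPEN; BSD is proved for no curve.
[cite: Kobayashi2003, Conjecture (p. 2), Thm. 1.2, Thm. 4.1, Thm. 7.4 (p. 13)] [cite: Pollack2003, Prop. 6.18, Cor. 5.11]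
[cite: Cremona2006, Table 1 (Cremona label 245456c1)] -/
theorem kobayashiMainConjecture_and_forall_kobayashiLowerDivisibility_c245456c1_7_of_prints_of_mazurTateRow
    (hJ : thm62_63_73_signedColemanKato_zetaJoint) (h12 : thm12_signedSelmerDual_finite_torsion) (h41 : thm41_signedCharIdeal_divisibility)
    (hD : Hida2000_thm326_exists_galoisRep) (hC : Carayol1986_artinConductorExponent)
    (hS : ∀ (V : WeierstrassCurve ℚ) (ℓ : ℕ) [Fact ℓ.Prime], V.swanConductorAt_rationalTate_eq_wildConductorExponent_of_ringChar_eq_two ℓ)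
    (hmod : exists_isNewformOf) (hKim : BDKim2009.cor213_signedLambda_add_sum_delta_eq_of_torsionIso)
    (hPR : PollackRubin2004.mainTheorem_signedCharIdeal_eq_of_cm) (hV : vatsal1999_plusSymbol_congruence)
    (hK211 : BDKim2009.prop211_selmer_noFiniteSubmodule) (hK2526 : BDKim2009.cor25_prop26_selmer_lambda_eq_add_sum_delta)
    (h53 : Literature.NumberTheory.ComplexMultiplication.EllipticUnits.JohnsonLeungKings2011.cor53_thm52ShapeO) (hKE : Literature.NumberTheory.ComplexMultiplication.EllipticUnits.Kato2004.sec155_exists_katoUnitRep)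
    (h24i : Literature.NumberTheory.ComplexMultiplication.EllipticUnits.DeShalit1987.prop24_i_mem_rayClassField) (h24ii : Literature.NumberTheory.ComplexMultiplication.EllipticUnits.DeShalit1987.prop24_ii_galoisAction)
    (h25 : Literature.NumberTheory.ComplexMultiplication.EllipticUnits.DeShalit1987.prop25_i_normRelation)
    (hKP : KimPark2017.prop212_prop33_localSignedDual_free_rank_two) (hKPd : KimPark2017.def210_prop212_exists_signedNormSystem)
    (hKP29 : KimPark2017.def210_prop29_exists_signedNormSystem_logSum)
    (hF1 : Literature.NumberTheory.EllipticCurves.Kato2004.CM.prop159_ellipticUnits_tatePairing_values_inert)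
    (hRes : Literature.NumberTheory.EllipticCurves.ModularForms.Ribet1977_cmNewform_gamma0_badEulerFactor_padicCharacter)
    (W : WeierstrassCurve ℚ) [W.IsElliptic] [W.IsGloballyMinimal] [Fact (Nat.Prime 7)]
    (hW : W = ⟨0, 1, 0, -162533, -51299309⟩) (hNS : ¬ W.HasSurjectiveModNGaloisRep 7)
    (hrow : ∀ [NeZero (W.conductorNorm ℤ)] (f : CuspForm (Gamma0 (W.conductorNorm ℤ)) 2), IsNewformOf W f →
      ∃ Θ : IwasawaAlgebra 7, iwasawaToPowerSeries 7 Θ =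
          ((mazurTateElement f 7 2).map (algebraMap ℚ ℚ_[7]) : PowerSeries ℚ_[7]) ∧
        Θ ≠ 0 ∧ mu Θ = 0 ∧ lam Θ = (cyclotomicOmegaMinus 7 2).natDegree + 2) :
    KobayashiMainConjecture W 7 1 ∧ ∀ ε : ℤˣ, KobayashiLowerDivisibility W 7 ε := by
  obtain ⟨hX, hap, hcm⟩ := classX7_frobeniusTrace_not_hasCM_c245456c1_7 W hW
  have hMC : KobayashiMainConjecture W 7 1 :=
    kobayashiMainConjecture_of_prints_of_oneSignFloorAt hJ h12 h41 hD hC hS hmod hKim hPR hV hK211 hK2526 h53 hKE h24i h24ii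
      h25 hKP hKPd hKP29 hF1 hRes W 7 (by norm_num) hX hcm hap hNS 1
      (fun f hf Lplus Lminus hPP ↦ SmallImageRttOneSided.oneSignFloor_of_mazurTateRowEven W 7 (by norm_num) hX.1.1 hap
        (by decide : Even 2) hrow f hf Lplus Lminus hPP)
  exact ⟨hMC, fun ε ↦ (SignDefect.X7.exists_kobayashiLowerDivisibility_iff_forall W 7 h12
    Summit.BirchSwinnertonDyer.BirchSwinnertonDyer.Theorems.realPeriodRat_eq_unit_mul_plusPeriod_holds
    Summit.BirchSwinnertonDyer.BirchSwinnertonDyer.Theorems.realPeriodRat_eq_unit_mul_plusPeriod_three_holds hJ (by norm_num) hX hap).mp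
    ⟨1, kobayashiLowerDivisibility_of_mainConjecture hMC⟩ ε⟩

/-- ★ **PER-PAIR CONDITIONAL RECORD — `353925ce1 @ 7`: Kobayashi's signed main conjecture `KobayashiMainConjecture W 7 (+1)` (certified sign
`ε₀ = +1`) AND lower divisibility for BOTH signs**, modulo (i) the 22 typed print facts of crux L's cite stub (`hJ … hRes`, hypotheses; typed ≠
proved), (ii) ONE displayed two-engine Mazur–Tate row `hrow` — kit j335262 `gvkan2/LAYERS.tsv` 09c04126f37ca31c, row `353925ce1@7, level 3 = Pollack
index 2, even, q = deg ω₂⁻ = 6`: `μ = 0, λ = 8 = 6 + 2`, engines B (`msengine`+`iwlayer`) and E (`eclib`) AGREE (lower rows: index 1 odd `μ = 0, λ = 2`; index 0 `μ = 1`, i.e. `7 ∣ L(E,1)/Ω = 56`)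
⇒ `(μ, λ)(L⁺₇(E)) = (0, 2)` — and (iii) ONE displayed image datum `hNS : ¬ Surj W 7` (option (b1)). BY NAME: P6's
`kobayashiMainConjecture_of_prints_of_oneSignFloorAt` ∘ `SmallImageRttOneSided.oneSignFloor_of_mazurTateRowEven`, then sign idleness on X7; kernel: §1.
Per pair; closes nothing class-wide; 23599, crux L, crux M and BSD remain OPEN; BSD is proved for no curve.
[cite: Kobayashi2003, Conjecture (p. 2), Thm. 1.2, Thm. 4.1, Thm. 7.4 (p. 13)] [cite: Pollack2003, Prop. 6.18, Cor. 5.11]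
[cite: Cremona2006, Table 1 (Cremona label 353925ce1)] -/
theorem kobayashiMainConjecture_and_forall_kobayashiLowerDivisibility_c353925ce1_7_of_prints_of_mazurTateRow
    (hJ : thm62_63_73_signedColemanKato_zetaJoint) (h12 : thm12_signedSelmerDual_finite_torsion) (h41 : thm41_signedCharIdeal_divisibility)
    (hD : Hida2000_thm326_exists_galoisRep) (hC : Carayol1986_artinConductorExponent)
    (hS : ∀ (V : WeierstrassCurve ℚ) (ℓ : ℕ) [Fact ℓ.Prime], V.swanConductorAt_rationalTate_eq_wildConductorExponent_of_ringChar_eq_two ℓ)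
    (hmod : exists_isNewformOf) (hKim : BDKim2009.cor213_signedLambda_add_sum_delta_eq_of_torsionIso)
    (hPR : PollackRubin2004.mainTheorem_signedCharIdeal_eq_of_cm) (hV : vatsal1999_plusSymbol_congruence)
    (hK211 : BDKim2009.prop211_selmer_noFiniteSubmodule) (hK2526 : BDKim2009.cor25_prop26_selmer_lambda_eq_add_sum_delta)
    (h53 : Literature.NumberTheory.ComplexMultiplication.EllipticUnits.JohnsonLeungKings2011.cor53_thm52ShapeO) (hKE : Literature.NumberTheory.ComplexMultiplication.EllipticUnits.Kato2004.sec155_exists_katoUnitRep)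
    (h24i : Literature.NumberTheory.ComplexMultiplication.EllipticUnits.DeShalit1987.prop24_i_mem_rayClassField) (h24ii : Literature.NumberTheory.ComplexMultiplication.EllipticUnits.DeShalit1987.prop24_ii_galoisAction)
    (h25 : Literature.NumberTheory.ComplexMultiplication.EllipticUnits.DeShalit1987.prop25_i_normRelation)
    (hKP : KimPark2017.prop212_prop33_localSignedDual_free_rank_two) (hKPd : KimPark2017.def210_prop212_exists_signedNormSystem)
    (hKP29 : KimPark2017.def210_prop29_exists_signedNormSystem_logSum)
    (hF1 : Literature.NumberTheory.EllipticCurves.Kato2004.CM.prop159_ellipticUnits_tatePairing_values_inert)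
    (hRes : Literature.NumberTheory.EllipticCurves.ModularForms.Ribet1977_cmNewform_gamma0_badEulerFactor_padicCharacter)
    (W : WeierstrassCurve ℚ) [W.IsElliptic] [W.IsGloballyMinimal] [Fact (Nat.Prime 7)]
    (hW : W = ⟨0, 0, 1, 147741000, 99524485156⟩) (hNS : ¬ W.HasSurjectiveModNGaloisRep 7)
    (hrow : ∀ [NeZero (W.conductorNorm ℤ)] (f : CuspForm (Gamma0 (W.conductorNorm ℤ)) 2), IsNewformOf W f →
      ∃ Θ : IwasawaAlgebra 7, iwasawaToPowerSeries 7 Θ =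
          ((mazurTateElement f 7 2).map (algebraMap ℚ ℚ_[7]) : PowerSeries ℚ_[7]) ∧
        Θ ≠ 0 ∧ mu Θ = 0 ∧ lam Θ = (cyclotomicOmegaMinus 7 2).natDegree + 2) :
    KobayashiMainConjecture W 7 1 ∧ ∀ ε : ℤˣ, KobayashiLowerDivisibility W 7 ε := by
  obtain ⟨hX, hap, hcm⟩ := classX7_frobeniusTrace_not_hasCM_c353925ce1_7 W hW
  have hMC : KobayashiMainConjecture W 7 1 :=
    kobayashiMainConjecture_of_prints_of_oneSignFloorAt hJ h12 h41 hD hC hS hmod hKim hPR hV hK211 hK2526 h53 hKE h24i h24ii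
      h25 hKP hKPd hKP29 hF1 hRes W 7 (by norm_num) hX hcm hap hNS 1
      (fun f hf Lplus Lminus hPP ↦ SmallImageRttOneSided.oneSignFloor_of_mazurTateRowEven W 7 (by norm_num) hX.1.1 hap
        (by decide : Even 2) hrow f hf Lplus Lminus hPP)
  exact ⟨hMC, fun ε ↦ (SignDefect.X7.exists_kobayashiLowerDivisibility_iff_forall W 7 h12
    Summit.BirchSwinnertonDyer.BirchSwinnertonDyer.Theorems.realPeriodRat_eq_unit_mul_plusPeriod_holds
    Summit.BirchSwinnertonDyer.BirchSwinnertonDyer.Theorems.realPeriodRat_eq_unit_mul_plusPeriod_three_holds hJ (by norm_num) hX hap).mp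
    ⟨1, kobayashiLowerDivisibility_of_mainConjecture hMC⟩ ε⟩

end Summit.BirchSwinnertonDyer.BirchSwinnertonDyer.Theorems.SmallImageRttLine

end
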